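import Literature.Topology.FourManifolds.SegFrame
import Literature.Topology.FourManifolds.HostToSummand
import HarnessLib

/-!
# The first segment conjugation: segment data from the host and the chord host

Topic `Literature/Topology/FourManifolds` (trunk T-4MAN). Fact seat
`provefact-Literature.Topology.FourManifolds.Knot.IsConnectedSum.isIsotopic` (Schubert's theorem),
geometric heart for rail knots, assembly step (2b), first part. Data: `b : BandData A B K ∅` and
`b' : BandData A B K' ∅` in normal position, `c'` a transport of `b'` (`b'.IsTransport c'`, so
`(c', b')` is a flip pair and `B_{c'} = R ∘ A`), the reference host `P.host` of `b`
(`HostToSummand.lean`, unit scale `λ_ref`, bend radius `r_ref`) and the chord host `H` of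
`ChordHost.lean` built from `(c', b')` over the circle of `b`.

* `isIsotopic_host_chordHost`: `P.host ≃ A ≃ H` (`HostToSummand.isIsotopic_host_A`,
  `ChordHost.isIsotopic_chordHost`, `(A.map R).map R = A`);
* `segData`: the resulting **segment data** (`SegmentConj.SegData`): an ambient isotopy `Ψ` with
  `Ψ₁ ∘ host = H`, whose end stage carries the straight segment `o + [-1, 1/2] d` of the host
  (`o = oS`, `d = κ frame dLo`) onto the chord `o' + [-1, 1/2] d'` of `b'`, clock for clock.

Everything is proved; no named facts are introduced.

## References

* M. W. Hirsch, *Differential Topology*, Springer GTM 33 (1976), Ch. 8 §1. [HirschDT1976]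
-/

open scoped Manifold ContDiff Topology Real
open Function Set Metric Filter

noncomputable section

namespace Literature.Topology.FourManifolds

/-- Local notation: `𝔼 n` is the model Euclidean space `EuclideanSpace ℝ (Fin n)`. -/
local notation "𝔼 " n:arg => EuclideanSpace ℝ (Fin n)

/-- Local notation: `𝕊 n` is the unit sphere in `EuclideanSpace ℝ (Fin (n + 1))`. -/
local notation "𝕊 " n:arg => (Metric.sphere (0 : EuclideanSpace ℝ (Fin (n + 1))) 1)

attribute [local instance] fact_finrank_euclideanSpace_succ

open KnotsInBall ExitBend SegmentConj

namespace BandData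

/-- A knot mapped twice by the reflection is the knot. [folklore] -/
theorem map_reflectLast_map_reflectLast (K : Knot) : (K.map (reflectLastDiffeo 3)).map (reflectLastDiffeo 3) = K :=
  DFunLike.coe_injective (funext fun x ↦ by
    simp only [SphereEmbedding.map_apply, coe_reflectLastDiffeo, reflectLast_reflectLast])

section One

variable {A B K K' : Knot} {b : BandData A B K ∅} {b' : BandData A B K' ∅}
  {c' : BandData (B.map (reflectLastDiffeo 3)) (A.map (reflectLastDiffeo 3)) (K'.map (reflectLastDiffeo 3)) ∅}
  {hcross : b.band ⁻¹' sphereEquator 2 ∩ squareNhd b.δ = {x ∈ squareNhd b.δ | x 0 = 2⁻¹}}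
  {hcross' : b'.band ⁻¹' sphereEquator 2 ∩ squareNhd b'.δ = {x ∈ squareNhd b'.δ | x 0 = 2⁻¹}}
  {hcrossc : c'.band ⁻¹' sphereEquator 2 ∩ squareNhd c'.δ = {x ∈ squareNhd c'.δ | x 0 = 2⁻¹}}
  -- the reference host of `b`
  {ε r A' κ lamR rAR : ℝ} (P : b.HostHyp hcross ε r A' κ lamR rAR)
  {εf rf : ℝ} (hf : b.IsFlat hcross εf rf) (hεf : εf ≤ HostHyp.epsU) (hrf : 4 * κ < rf) (hκt : κ * tgtLip ≤ 1)
  -- the flip pair `(c', b')`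
  (hP : IsFlipPair c' b')
  {ε₁ r₁ A₁' κ₁ ε₂ r₂ : ℝ} (HU₁ : c'.ShrinkScaleU hcrossc ε₁ r₁ A₁' κ₁) (h₂ : b'.ArcScale hcross' ε₂ r₂ κ₁)
  (hT : PairScale hP hcross' hcrossc κ₁)
  {ε₁' r₁' : ℝ} (hf₁ : c'.IsFlat hcrossc ε₁' r₁') (hε₁ : ε₁' ≤ 1 / 100) (hr₁ : 5 * κ₁ < r₁')

/-- The summands of the transport: `R ∘ B` north, `R ∘ A` south, disjoint; `B` south. [folklore] -/
theorem transport_hemispheres (hA : A.InNorth) (hB : B.InSouth) :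
    (B.map (reflectLastDiffeo 3)).InNorth ∧ (A.map (reflectLastDiffeo 3)).InSouth ∧
      Disjoint (range (B.map (reflectLastDiffeo 3))) (range (A.map (reflectLastDiffeo 3))) :=
  ⟨hB.map_reflectLast, hA.map_reflectLast, Knot.disjoint_range_of_inNorth_inSouth hB.map_reflectLast hA.map_reflectLast⟩

/-- **The chord host of the assembly**: the reflected flip knot of `(c', b')` over the circle of `b`,
with the clock of the reference host. [folklore] -/
def chordH : Knot :=
  b.chordHost P.HU P.hl P.hl2 HU₁ h₂ hP hT hf₁ hε₁ hr₁ (transport_hemispheres P.hA P.hB).1 (transport_hemispheres P.hA P.hB).2.1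
    (transport_hemispheres P.hA P.hB).2.2 P.hB

/-- **The chord host is isotopic to `A`.** [cite: HirschDT1976, Ch. 8 §1, Thm. 1.3] -/
theorem isIsotopic_chordH_A : (chordH P hP HU₁ h₂ hT hf₁ hε₁ hr₁).IsIsotopic A := by
  have h := b.isIsotopic_chordHost P.HU P.hl P.hl2 HU₁ h₂ hP hT hf₁ hε₁ hr₁ (transport_hemispheres P.hA P.hB).1
    (transport_hemispheres P.hA P.hB).2.1 (transport_hemispheres P.hA P.hB).2.2 P.hB rfl
  rw [map_reflectLast_map_reflectLast] at h
  exact h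

include hf hεf hrf hκt in
/-- **THE HOST IS ISOTOPIC TO THE CHORD HOST** (both are isotopic to `A`).
[cite: HirschDT1976, Ch. 8 §1, Thm. 1.3] -/
theorem isIsotopic_host_chordH : P.host.IsIsotopic (chordH P hP HU₁ h₂ hT hf₁ hε₁ hr₁) :=
  IsAmbientIsotopic.trans_holds (P.isIsotopic_host_A hf hεf hrf hκt) (IsAmbientIsotopic.symm_holds (isIsotopic_chordH_A P hP HU₁ h₂ hT hf₁ hε₁ hr₁))

/-! ### The straight host segment -/

/-- **The segment centre**: `oS = blowDown O`. [folklore] -/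
def segO (_ : b.HostHyp hcross ε r A' κ lamR rAR) : 𝔼 3 := b.oS hcross κ b.depthSign

/-- **The segment direction**: `κ frame dLo`. [folklore] -/
def segD (_ : b.HostHyp hcross ε r A' κ lamR rAR) : 𝔼 3 := κ • b.frame hcross (dLo b.depthSign)

/-- The blow-down of the lower line is the segment: `blowDown (O + ρ dLo) = o + ρ d`. [folklore] -/
theorem blowDown_lowerPt (ρ : ℝ) : b.blowDown hcross κ (lowerPt b.depthSign ρ) = segO P + ρ • segD P := by
  simp only [segO, segD, oS, lowerPt, blowDown, cO, map_add, map_smul, smul_add, smul_smul, mul_comm ρ κ]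
  rw [add_assoc]

/-- The segment direction is nonzero. [folklore] -/
theorem segD_ne_zero : segD P ≠ 0 := by
  have hκ := P.HU.cone.spike.κ_pos
  have hd : dLo b.depthSign ≠ 0 := fun h ↦ by
    have := norm_dLo_sq b.depthSign_sq; rw [h, norm_zero] at this; norm_num at this
  simp only [segD]
  refine smul_ne_zero hκ.ne' fun h0 ↦ hd ((b.frame hcross).injective ?_)
  rw [h0, map_zero]

/-- **The straight parameters map into the chart zone of the host** (`αLo, αHi ≥ 0`). [folklore] -/
theorem str_subset_zero : Icc (b.strLo P.HU) (b.strHi P.HU) ⊆ Icc (P.paramLo HostHyp.zero_mem07) (P.paramHi HostHyp.zero_mem07) := by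
  have h := P.HU.cone.spike
  have hκ := h.κ_pos
  obtain ⟨hl1, hl2⟩ := P.paramLo_spec HostHyp.zero_mem07
  obtain ⟨hh1, hh2⟩ := P.paramHi_spec HostHyp.zero_mem07
  have c1 := b.parLo_mem_core hκ h.seven_le_gapLo quarter_mem7
  have c2 := b.parHi_mem_core hκ h.seven_le_gapHi quarter_mem7
  have hε := b.epsLo_bounds.1
  have hε' := b.epsHi_bounds.1
  intro s hs
  constructor
  · have : P.paramLo HostHyp.zero_mem07 < b.strLo P.HU := by
      by_contra hle; push Not at hle
      have := (P.alphaLo_le_iff HostHyp.zero_mem07 c1).2 hle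
      simp only [b.alphaLo_parLo hκ h.seven_le_gapLo quarter_mem7] at this
      norm_num at this
    linarith [hs.1]
  · have : b.strHi P.HU < P.paramHi HostHyp.zero_mem07 := by
      by_contra hle; push Not at hle
      have := (P.alphaHi_le_iff HostHyp.zero_mem07 c2).2 hle
      simp only [b.alphaHi_parHi hκ h.seven_le_gapHi quarter_mem7] at this
      norm_num at this
    linarith [hs.2]

/-- **THE HOST ON THE STRAIGHT SEGMENT**: for `u ∈ [strLo, winHi]`,
`host (circlePt u) = ψ⁻¹ (o + clockFn u • d)`. [folklore] -/
theorem host_circlePt_of_mem {u : ℝ} (hu : u ∈ Icc (b.strLo P.HU) (b.winHi P.HU P.hl)) :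
    P.host (circlePt u) = psiN.symm (segO P + b.clockFn P.HU P.hl P.hl2 u • segD P) := by
  have h := P.HU.cone.spike
  have hκ := h.κ_pos
  obtain ⟨m1, m2, m3, m3', m4, m5⟩ := b.str_marks P.HU P.hl
  have hz := str_subset_zero P ⟨hu.1, by linarith [hu.2]⟩
  apply Subtype.ext
  have e := P.coe_hostPt_eq hz
  simp only [HostHyp.hostPt] at e
  rw [e, ← blowDown_lowerPt P]
  congr 2
  rcases le_or_gt u (b.winLo P.HU P.hl) with h1 | h1
  · -- lower ray and stub: `trk = lowerPt (-psiLo)`, `clockFn = -psiLo`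
    have hcore : u ∈ Icc (b.tcLo - b.epsLo / 8) (b.tcLo + b.epsLo / 8) :=
      ⟨by linarith [hu.1], by linarith [(b.winLo_mem_core P.HU P.hl).2]⟩
    have hα : b.alphaLo κ u ∈ Icc (1 / 4 : ℝ) (3 / 4) := by
      constructor
      · rw [← b.alphaLo_parLo hκ h.seven_le_gapLo quarter_mem7]
        exact (b.strictMonoOn_alphaLo hκ).monotoneOn (b.parLo_mem_core hκ h.seven_le_gapLo quarter_mem7) hcore hu.1
      · -- `psiLo u ≥ psiLo winLo = 1/2 > λ/3·`: `αLo u ≤ αLo winLo < 3/4`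
        have hc := cOne_mem P.hl
        obtain ⟨-, hwv⟩ := b.clockLo_spec P.HU P.hl half_mem_Icc
        have hαw : b.alphaLo κ (b.winLo P.HU P.hl) < 3 / 4 := by
          by_contra hle; push Not at hle
          have hanti := strictAntiOn_spikeScalar hc
          have h3 : spikeScalar (1 * (1 - lamR)) (b.alphaLo κ (b.winLo P.HU P.hl)) ≤ spikeScalar (1 * (1 - lamR)) (3 / 4) := by
            rcases hle.eq_or_lt with h4 | h4
            · rw [h4]
            · have hα1 : b.alphaLo κ (b.winLo P.HU P.hl) < 1 := by
                by_contra h5; push Not at h5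
                have := spikeScalar_nonpos hc h5
                have h6 : b.psiLo κ lamR (b.winLo P.HU P.hl) = 1 / 2 := hwv
                simp only [psiLo] at h6; linarith
              exact (hanti (show (3/4:ℝ) ∈ Iio (1:ℝ) by norm_num) (show b.alphaLo κ (b.winLo P.HU P.hl) ∈ Iio (1:ℝ) from hα1) h4).le
          rw [spikeScalar_three_quarters] at h3
          have h6 : b.psiLo κ lamR (b.winLo P.HU P.hl) = 1 / 2 := hwv
          simp only [psiLo] at h6
          have := P.hl2; linarith
        exact ((b.strictMonoOn_alphaLo hκ).monotoneOn hcore (b.winLo_mem_core P.HU P.hl) h1).trans hαw.le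
    rw [P.trk_lower hcore hα (by linarith [b.winLo_lt_collarLo P.HU P.hl P.hl2]),
      b.clockFn_of_le_collarLo P.HU P.hl P.hl2 (by linarith [b.winLo_lt_collarLo P.HU P.hl P.hl2])]
  · rw [P.trk_window ⟨h1.le, hu.2⟩]

/-- **Every clock in `[-1, 1/2]` is attained on the straight host segment.** [folklore] -/
theorem exists_clockFn_eq {ρ : ℝ} (hρ : ρ ∈ Icc (-1 : ℝ) (1 / 2)) :
    ∃ u ∈ Icc (b.strLo P.HU) (b.winHi P.HU P.hl), b.clockFn P.HU P.hl P.hl2 u = ρ := by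
  obtain ⟨m1, m2, m3, m3', m4, m5⟩ := b.str_marks P.HU P.hl
  obtain ⟨v1, -⟩ := b.clockFn_strLo_strHi P.HU P.hl P.hl2
  have v2 := b.clockFn_winHi P.HU P.hl P.hl2
  have hww : b.winLo P.HU P.hl < b.winHi P.HU P.hl := by
    linarith [b.winLo_lt_collarLo P.HU P.hl P.hl2, b.collarLo_lt_collarHi P.HU P.hl P.hl2, b.collarHi_lt_winHi P.HU P.hl P.hl2]
  have hcont := (b.contDiff_clockFn P.HU P.hl P.hl2).continuous.continuousOn (s := Icc (b.strLo P.HU) (b.winHi P.HU P.hl))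
  have hy : ρ ∈ Icc (b.clockFn P.HU P.hl P.hl2 (b.strLo P.HU)) (b.clockFn P.HU P.hl P.hl2 (b.winHi P.HU P.hl)) := by
    rw [v1, v2]; exact hρ
  exact intermediate_value_Icc (by linarith) hcont hy

/-! ### The segment data -/

include hf hεf hrf hκt in
/-- **Existence of the ambient isotopy of the first conjugation.** [cite: HirschDT1976, Ch. 8 §1, Thm. 1.3] -/
theorem exists_Psi : ∃ Ψ : AmbientIsotopy (𝓡 3) (𝕊 3), Ψ.toFun 1 ∘ ⇑P.host = ⇑(chordH P hP HU₁ h₂ hT hf₁ hε₁ hr₁) :=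
  isIsotopic_host_chordH P hf hεf hrf hκt hP HU₁ h₂ hT hf₁ hε₁ hr₁

/-- **The ambient isotopy** `Ψ` with `Ψ₁ ∘ host = H`. [folklore] -/
def Psi : AmbientIsotopy (𝓡 3) (𝕊 3) := (exists_Psi P hf hεf hrf hκt hP HU₁ h₂ hT hf₁ hε₁ hr₁).choose

/-- `Ψ₁ ∘ host = H`. [folklore] -/
theorem Psi_host (x : 𝕊 1) : stageOne (Psi P hf hεf hrf hκt hP HU₁ h₂ hT hf₁ hε₁ hr₁) (P.host x) = chordH P hP HU₁ h₂ hT hf₁ hε₁ hr₁ x := by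
  have := congrFun (exists_Psi P hf hεf hrf hκt hP HU₁ h₂ hT hf₁ hε₁ hr₁).choose_spec x
  rw [comp_apply] at this
  rw [← this, stageOne, AmbientIsotopy.coe_toDiffeomorph]
  rfl

/-- **THE SEGMENT DATA OF THE FIRST CONJUGATION.** [folklore] -/
def segData : SegData where
  Ψ := Psi P hf hεf hrf hκt hP HU₁ h₂ hT hf₁ hε₁ hr₁
  o := segO P
  o' := chordO h₂
  d := segD P
  d' := chordD h₂
  ρlo := -1
  ρhi := 1 / 2
  d_ne := segD_ne_zero P
  ρlo_neg := by norm_num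
  ρhi_pos := by norm_num
  seg ρ hρ := by
    obtain ⟨u, hu, huρ⟩ := exists_clockFn_eq P hρ
    obtain ⟨m1, m2, m3, m3', m4, m5⟩ := b.str_marks P.HU P.hl
    rw [← huρ, ← host_circlePt_of_mem P hu, Psi_host, chordH,
      b.chordHost_circlePt_of_mem P.HU P.hl P.hl2 HU₁ h₂ hP hT hf₁ hε₁ hr₁ _ _ _ _ ⟨hu.1, by linarith [hu.2]⟩]

/-- The fields of the segment data. [folklore] -/
@[simp] theorem segData_o : (segData P hf hεf hrf hκt hP HU₁ h₂ hT hf₁ hε₁ hr₁).o = segO P := rfl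
/-- The fields of the segment data. [folklore] -/
@[simp] theorem segData_o' : (segData P hf hεf hrf hκt hP HU₁ h₂ hT hf₁ hε₁ hr₁).o' = chordO h₂ := rfl
/-- The fields of the segment data. [folklore] -/
@[simp] theorem segData_d : (segData P hf hεf hrf hκt hP HU₁ h₂ hT hf₁ hε₁ hr₁).d = segD P := rfl
/-- The fields of the segment data. [folklore] -/
@[simp] theorem segData_d' : (segData P hf hεf hrf hκt hP HU₁ h₂ hT hf₁ hε₁ hr₁).d' = chordD h₂ := rfl
/-- The fields of the segment data. [folklore] -/
@[simp] theorem segData_ρlo : (segData P hf hεf hrf hκt hP HU₁ h₂ hT hf₁ hε₁ hr₁).ρlo = -1 := rfl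
/-- The fields of the segment data. [folklore] -/
@[simp] theorem segData_ρhi : (segData P hf hεf hrf hκt hP HU₁ h₂ hT hf₁ hε₁ hr₁).ρhi = 1 / 2 := rfl
/-- The fields of the segment data. [folklore] -/
theorem segData_Ψ : (segData P hf hεf hrf hκt hP HU₁ h₂ hT hf₁ hε₁ hr₁).Ψ = Psi P hf hεf hrf hκt hP HU₁ h₂ hT hf₁ hε₁ hr₁ := rfl

/-! ### The far radius -/

/-- **THE FAR RADIUS**: the chord host points of parameters off the open straight range
`(strLo, winHi)` are the north pole or at chart distance `≥ R₁ > 0` from the chord centre `o'`.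
[folklore] -/
theorem exists_far_radius : ∃ R₁ > 0, ∀ t ∈ Icc b.alo (b.alo + 1), t ∉ Ioo (b.strLo P.HU) (b.winHi P.HU P.hl) →
    chordH P hP HU₁ h₂ hT hf₁ hε₁ hr₁ (circlePt t) = northPole ∨
      R₁ ≤ ‖psiN (chordH P hP HU₁ h₂ hT hf₁ hε₁ hr₁ (circlePt t)) - chordO h₂‖ := by
  set H := chordH P hP HU₁ h₂ hT hf₁ hε₁ hr₁ with hH
  obtain ⟨m1, m2, m3, m3', m4, m5⟩ := b.str_marks P.HU P.hl
  have hcm := b.core_marks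
  have hwc := b.winHi_mem_core P.HU P.hl
  have hlc := b.parLo_mem_core P.HU.cone.spike.κ_pos P.HU.cone.spike.seven_le_gapLo quarter_mem7
  have hε := b.epsLo_bounds.1
  -- the centre parameter `t₀`, strictly inside the straight range
  obtain ⟨t₀, ht₀, ht₀v⟩ := exists_clockFn_eq P (ρ := 0) ⟨by norm_num, by norm_num⟩
  obtain ⟨v1, -⟩ := b.clockFn_strLo_strHi P.HU P.hl P.hl2
  have v2 := b.clockFn_winHi P.HU P.hl P.hl2
  have ht₀1 : b.strLo P.HU < t₀ := lt_of_le_of_ne ht₀.1 fun h ↦ by rw [← h, v1] at ht₀v; norm_num at ht₀v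
  have ht₀2 : t₀ < b.winHi P.HU P.hl := lt_of_le_of_ne ht₀.2 fun h ↦ by rw [h, v2] at ht₀v; norm_num at ht₀v
  have hx₀ : H (circlePt t₀) = psiN.symm (chordO h₂) := by
    rw [hH, chordH, b.chordHost_circlePt_of_mem P.HU P.hl P.hl2 HU₁ h₂ hP hT hf₁ hε₁ hr₁ _ _ _ _ ⟨ht₀.1, by linarith [ht₀.2]⟩, ht₀v,
      zero_smul, add_zero]
  have halo : b.alo < b.strLo P.HU := by
    have : b.strLo P.HU = b.parLo P.HU.cone.spike.κ_pos P.HU.cone.spike.seven_le_gapLo quarter_mem7 := rfl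
    linarith [hlc.1]
  have halo' : b.winHi P.HU P.hl < b.alo + 1 := by linarith [hwc.2]
  -- the compact parameter set and the distance function
  set T : Set ℝ := Icc b.alo (b.alo + 1) \ Ioo (b.strLo P.HU) (b.winHi P.HU P.hl) with hT'
  have hTc : IsCompact T := isCompact_Icc.diff isOpen_Ioo
  have hTne : T.Nonempty := ⟨b.alo, ⟨left_mem_Icc.2 (by linarith), fun h ↦ by linarith [h.1]⟩⟩
  set f : ℝ → 𝔼 4 := fun t ↦ ((H (circlePt t) : 𝕊 3) : 𝔼 4) with hf'
  have hfc : Continuous f := by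
    have : f = Knot.curve H := funext fun t ↦ (Knot.curve_apply (K := H) t).symm
    rw [this]; exact H.continuous_curve
  set g : ℝ → ℝ := fun t ↦ ‖f t - f t₀‖ with hg'
  have hgc : Continuous g := (hfc.sub continuous_const).norm
  have hpos : ∀ t ∈ T, 0 < g t := by
    intro t ht
    simp only [hg', norm_pos_iff, sub_ne_zero, hf']
    intro he
    have he' : Knot.curve H t = Knot.curve H t₀ := by rw [Knot.curve_apply, Knot.curve_apply]; exact he
    obtain ⟨m, hm⟩ := H.curve_eq_curve_iff.1 he'
    have h1 : (m : ℝ) < 1 := by linarith [ht.1.2]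
    have h2 : (-1 : ℝ) < m := by linarith [ht.1.1]
    have h1' : m < 1 := by exact_mod_cast h1
    have h2' : -1 < m := by exact_mod_cast h2
    have hm0 : m = 0 := by omega
    rw [hm0, Int.cast_zero, add_zero] at hm
    exact ht.2 ⟨by rw [hm]; exact ht₀1, by rw [hm]; exact ht₀2⟩
  obtain ⟨tm, htm, hmin⟩ := hTc.exists_isMinOn hTne hgc.continuousOn
  set m := g tm with hm'
  have hm0 : 0 < m := hpos tm htm
  -- continuity of `ψ⁻¹` (read in `ℝ⁴`) at `o'`
  have hcs : Continuous fun y : 𝔼 3 ↦ ((psiN.symm y : 𝕊 3) : 𝔼 4) := contDiff_coe_psiN_symm.continuous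
  obtain ⟨R₁, hR₁, hR⟩ := Metric.continuousAt_iff.1 (hcs.continuousAt (x := chordO h₂)) m hm0
  refine ⟨R₁, hR₁, fun t ht hts ↦ ?_⟩
  by_cases hN : H (circlePt t) = northPole
  · exact Or.inl hN
  · right
    by_contra hlt
    push Not at hlt
    have h1 := hR (by rw [dist_eq_norm]; exact hlt)
    rw [psiN_symm_apply_psiN hN, dist_eq_norm] at h1
    have h2 : m ≤ g t := hmin ⟨ht, hts⟩
    have e : ((psiN.symm (chordO h₂) : 𝕊 3) : 𝔼 4) = f t₀ := by simp only [hf']; rw [hx₀]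
    rw [e] at h1
    exact absurd h2 (not_le.2 h1)

end One


/-! ### The wall reference of the first conjugation -/

section Inst

variable {A B K K' : Knot} {b : BandData A B K ∅} {b' : BandData A B K' ∅}
  {c' : BandData (B.map (reflectLastDiffeo 3)) (A.map (reflectLastDiffeo 3)) (K'.map (reflectLastDiffeo 3)) ∅}
  {hcross : b.band ⁻¹' sphereEquator 2 ∩ squareNhd b.δ = {x ∈ squareNhd b.δ | x 0 = 2⁻¹}}
  {hcross' : b'.band ⁻¹' sphereEquator 2 ∩ squareNhd b'.δ = {x ∈ squareNhd b'.δ | x 0 = 2⁻¹}}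
  {hcrossc : c'.band ⁻¹' sphereEquator 2 ∩ squareNhd c'.δ = {x ∈ squareNhd c'.δ | x 0 = 2⁻¹}}
  {ε r A' κ : ℝ} (P : b.HostHyp hcross ε r A' κ (1 / 2) (1 / 8))
  {εf rf : ℝ} (hf : b.IsFlat hcross εf rf) (hεf : εf ≤ HostHyp.epsU) (hrf : 4 * κ < rf) (hκt : κ * tgtLip ≤ 1)
  (hP : IsFlipPair c' b')
  {ε₁ r₁ A₁' κ₁ ε₂ r₂ : ℝ} (HU₁ : c'.ShrinkScaleU hcrossc ε₁ r₁ A₁' κ₁) (h₂ : b'.ArcScale hcross' ε₂ r₂ κ₁)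
  (hT : PairScale hP hcross' hcrossc κ₁)
  {ε₁' r₁' : ℝ} (hf₁ : c'.IsFlat hcrossc ε₁' r₁') (hε₁ : ε₁' ≤ 1 / 100) (hr₁ : 5 * κ₁ < r₁')

/-- **The wall reference of the reference host hypotheses** (reference scale `λ = 1/2`, `r_A = 1/8`):
the spiked rail frame itself. [folklore] -/
theorem HostHyp.wallRef (P : b.HostHyp hcross ε r A' κ (1 / 2) (1 / 8)) : b.WallRef hcross ε r A' κ (b.spikePiece hcross κ b.depthSign 1) :=
  ⟨P.HU, P.hW, b.isBendClear_spikePiece P.HU.cone, fun _ _ ↦ rfl, P.hA, P.hB, P.hAB⟩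

/-- The reference host of the wall reference is the host. [folklore] -/
theorem HostHyp.wallRef_host : P.wallRef.host = P.host := rfl

/-- The bent knots of the wall reference are the bent knots of the rail frame. [folklore] -/
theorem HostHyp.wallRef_bent {lam₀ rA : ℝ} (hl₀ : lam₀ ∈ Ioc (0 : ℝ) 1) (hrA : 0 < rA) :
    P.wallRef.bent hl₀ hrA = b.bentKnot P.HU P.hW hl₀ hrA P.hB P.hAB := rfl

/-- The segment centre and direction of the wall reference. [folklore] -/
theorem HostHyp.wallRef_segO : P.wallRef.segO = segO P := rfl

/-- The segment centre and direction of the wall reference. [folklore] -/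
theorem HostHyp.wallRef_segD : P.wallRef.segD = segD P := rfl

/-- **The end stage of the first conjugation carries the reference host onto the chord host**, in
the form used by the frames of `SegFrame.lean`. [folklore] -/
theorem Psi_wallRef_host (x : 𝕊 1) :
    stageOne (segData P hf hεf hrf hκt hP HU₁ h₂ hT hf₁ hε₁ hr₁).Ψ (P.wallRef.host x) = chordH P hP HU₁ h₂ hT hf₁ hε₁ hr₁ x :=
  Psi_host P hf hεf hrf hκt hP HU₁ h₂ hT hf₁ hε₁ hr₁ x

end Inst

end BandData

end Literature.Topology.FourManifolds
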